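import Summits.QuantumFields.YangMills.Theorems.AlphaInputsT3ACv3Step
import Summits.QuantumFields.Balaban3D.Proofs.Thm2AC
import HarnessLib

/-!
# `AlphaInputsT3ACv3StepLow` — PRINT'S LOWER STEP ROW ON A VALIDITY FAMILY («R-57χ», owner RULING g23-№2 + ADDENDUM 1, cell ym3-torus, 2026-08-27):
# the χ_k of [Balaban1985UV3] (47) READ ON THE INPUT'S OWN MINIMISER, the lower row of p.272 L32–33 with that characteristic function on BOTH sides,
# the `dV`-a.e. (47)-induction it drives, and the pointwise (47) for the tower's (4)-window as a COROLLARY — lane `pub-balaban3d`, seat alpha-1 (g9)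

WHY.  The lane's residual R3D-02 `Bound55AC.Fibre57LowAC` (lead ruling R-CHI) displays the lower step bound with the tower's characteristic function
`T.χ_j = chiSmall univ (ε₁ j)` — the (4) SMALL-FIELD WINDOW ON THE FIELD at the running threshold `ε₁(j) = g_jp(g_j)` — on the left AND inside the
fibre integral.  Print's (47) p.267 carries instead «the characteristic function χ_k corresponds to the restrictions on V given by the conditions
|U_k(∂p) − 1| < g_kp(g_k)η², p ⊂ T_η» — a window on the MINIMISER `U_k = U_k(V)` (first step: p.265 L21–28 «where U₁ = U₁(V) is the minimal configuration
determined by V»), and p.272 L32–33 «the lower bound is proved in the same way» propagates THAT χ down the minimiser tower (the saddle point of the fibre of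
`V` has `U_k(V^{(k)}) = U_{k+1}(V)`, p.268 L14–17).  At block sizes `L ∈ {3, 5}` the field-window display is false for Bałaban's objects (cell finding #44 /
F-r1-g2-1: the Gaussian bulk of the fibre of a window-edge datum leaves the previous FIELD window; the minimiser window is hereditary with margin `L^{3/2}`).
The tower's `χ` is not a slot (it is `Balaban1985CMP102.Setting.RunObjects.chi` by definition), so the repair lives HERE, on the alpha side, as a row over
an explicit validity family (seat memo `AUDIT-alpha-rows-alpha1-g9.md` 2245d20d52086bbe, «H1ᴰ»).

CONTENTS (the row is a HYPOTHESIS SCHEMA, never asserted; everything else is proved):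
* §1 `chiMinAC 𝔎 X c k` — print's χ_k as a SET of level-`k` fields: «the minimiser `U_k(V)` (the input's `ukAll X.Uk k V`, a configuration on the finest
  lattice) has `|U_k(V)(∂p) − 1| < c·g_kp(g_k)·η²`, `η = L^{−k}`, at every plaquette» — window constant `c` DISPLAYED (print: `c = 1`; the T³ socket may take
  `c = max B₃ 1`, [Balaban1985Variational] Thm 1 (8), so that the (4)-window lies inside it); `U_0 = id`, so `chiMinAC … 0` is the (4)-window at `c·ε₁(0)`.
* §2 `Fibre57LowOnAC 𝔎 X 𝔖 lo k` — R3D-02's display with `T.χ ↦ 𝟙[lo]` on both sides, exponents BYTE-IDENTICAL ((37)/(57) left, (47)_k right), generic in the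
  lower validity family `lo : (k : ℕ) → Set (GaugeField S.P k G)`; displayed instance `lo := chiMinAC 𝔎 X c`.
* §3 `ineq47On_ae` — the `dV`-a.e. (47)-chain ON `lo`: given the rows for `k < K`, the χ-free exponent step (the leaves' bookkeeping, supplied as a
  hypothesis in the tower's letters) and the data rows, `𝟙[lo j]·e^{(47)_j exponent at triv} ≤ᵐ ρ_j` for every `j ≤ K` ((47)₀ = (1) p.256 with no χ; step = row
  + monotonicity/honesty of the RN transport).  No `T.χ` anywhere.
* §4 `ineq47_of_onRows` — if moreover the (4)-window of every level lies inside `lo` (`hsub`; at the T³ socket this IS the record's minimiser row r1 when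
  `c ≥ B₃`), then LQB's POINTWISE `B10.Ineq47 (towerOfAC 𝔎 X 𝔖) k` for the tower's own χ follows for every `k ≤ K`, through the run's lower-barrier version
  selection (`Carriers.run3_lower_le_rho_succ`; the barrier IS `T.χ_{k+1}·e^{(57) at triv}`) — so every consumer of the field-window (47)′ keeps its statement.
L-floor: none beyond the lane's.  [folklore] measure theory + bookkeeping; the analytic content is the row, which NODE O supplies.

References: T. Bałaban, Commun. Math. Phys. 102 (1985) 255–275 [Balaban1985UV3] ((4)–(5) p.256, (37) p.265, (47) p.267, p.268, p.272 L32–33);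
Commun. Math. Phys. 102 (1985) 277–309 [Balaban1985Variational] (Thm 1 (8) p.279).
-/

set_option autoImplicit false

noncomputable section

namespace Summit.QuantumFields.YangMills.Theorems.PinnedStep

open MeasureTheory
open Literature.MathematicalPhysics.QuantumFieldTheory.Balaban1983to89
open Literature.MathematicalPhysics.QuantumFieldTheory.Balaban1983to89.AveragingRT (rnTransport rnTransport_nonneg)
open Literature.MathematicalPhysics.QuantumFieldTheory.Balaban1983to89.B10 (Ineq47)
open Literature.MathematicalPhysics.QuantumFieldTheory.Balaban1985CMP102
open Literature.MathematicalPhysics.QuantumFieldTheory.Balaban1985CMP102.Setting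
open Summit.QuantumFields.Balaban3D.Carriers
open Summit.QuantumFields.Balaban3D.Proofs.Inputs (LaneConsts)
open Summit.QuantumFields.Balaban3D.Proofs.ScalesArithmetic (gk_pos gk_le_one)
open Summit.QuantumFields.Balaban3D.Proofs.TowerAC
open Summit.QuantumFields.Balaban3D.Proofs.StandardAC
open Summit.QuantumFields.Balaban3D.Proofs.InputsAC
open Summit.QuantumFields.Balaban3D.Proofs.Transport48 (integrable_weight_mul_exp rnTransport_mono_ae)
open Summit.QuantumFields.Balaban3D.Proofs (Bound55Std.measurable_actionEta Bound55Std.actionEta_nonneg)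

variable {L : ℕ} (𝔎 : LaneConsts L) {S : Scales L} {G : Type} [GaugeGroup G] [MeasurableSpace G] [HaarData G]
  {E : Type} [NormedAddCommGroup E] [NormedSpace ℂ E]
  (X : ExternalInputsAC S G) (𝔖 : ∀ k, StepSeries S G E (nblkOf S 𝔎.carrier k) k)

/-! ## §1 Print's `χ_k` of (47), read on the input's own minimiser -/

/-- **PRINT'S `χ_k` OF (47) AS A SET OF LEVEL-`k` FIELDS, WINDOW CONSTANT `c`**: `V ∈ chiMinAC 𝔎 X c k` iff the minimiser `U_k(V)` — the input's
`ukAll X.Uk k V`, a configuration on the finest lattice `T_η`, `η = L^{−k}` — satisfies `|U_k(V)(∂p) − 1| < c·g_kp(g_k)·η²` at EVERY plaquette of `T_η`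
(«the characteristic function χ_k corresponds to the restrictions on V given by the conditions |U_k(∂p) − 1| < g_kp(g_k)η², p ⊂ T_η», (47) p.267;
first step p.265 L21–28).  Print has `c = 1`; the constant is displayed so that a socket may enlarge the window (e.g. `c = max B₃ 1`, which puts the
(4)-window inside by [Balaban1985Variational] Thm 1 (8)).  `g_kp(g_k) = eps1Of S 𝔎.carrier k` is the lane's (4)/(7) threshold of level `k`.
[cite: Balaban1985UV3, (47) p.267] -/
def chiMinAC (c : ℝ) (k : ℕ) : Set (GaugeField S.P k G) :=
  {V | PlaqSmall (c * eps1Of S 𝔎.carrier k * ((L : ℝ)⁻¹) ^ (2 * k)) (ukAll X.Uk k V)}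

/-- Unfolding lemma. [cite: Balaban1985UV3, (47) p.267] -/
theorem mem_chiMinAC_iff (c : ℝ) (k : ℕ) (V : GaugeField S.P k G) :
    V ∈ chiMinAC 𝔎 X c k ↔ PlaqSmall (c * eps1Of S 𝔎.carrier k * ((L : ℝ)⁻¹) ^ (2 * k)) (ukAll X.Uk k V) :=
  Iff.rfl

/-- At `k = 0` (`U_0 = id`, `η = 1`) print's window is the (4)-window of the field itself at `c·ε₁(0)`. [cite: Balaban1985UV3, (4) p.256] -/
theorem mem_chiMinAC_zero_iff (c : ℝ) (V : GaugeField S.P 0 G) :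
    V ∈ chiMinAC 𝔎 X c 0 ↔ PlaqSmall (c * eps1Of S 𝔎.carrier 0) V := by
  rw [mem_chiMinAC_iff]
  simp only [mul_zero, pow_zero, mul_one]
  exact Iff.rfl

/-- `ε₁(k) = g_kp(g_k) > 0` for `k ≤ K` (`p(g) = b₀(1 + log g⁻¹)^{p₀}`, `b₀ > 0`, `0 < g_k ≤ 1`). [cite: Balaban1985UV3, (7) p.257] -/
theorem eps1Of_carrier_pos (k : ℕ) (hk : k ≤ S.K) : 0 < eps1Of S 𝔎.carrier k := by
  show 0 < S.gk k * B10.pFun 𝔎.F.b₀ 𝔎.F.p₀ (S.gk k)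
  exact mul_pos (gk_pos S k)
    (Summit.QuantumFields.Balaban3D.Proofs.CouplingWindow.pFun_pos _ _ _ 𝔎.F.b₀_pos (gk_pos S k) (gk_le_one S S.gK_le_one k hk))

/-- The window is monotone in its constant. [folklore] -/
theorem chiMinAC_mono {c c' : ℝ} (hcc' : c ≤ c') (k : ℕ) (hk : k ≤ S.K) : chiMinAC 𝔎 X c k ⊆ chiMinAC 𝔎 X c' k := by
  intro V hV p
  have hε : 0 ≤ eps1Of S 𝔎.carrier k * ((L : ℝ)⁻¹) ^ (2 * k) :=
    mul_nonneg (eps1Of_carrier_pos 𝔎 k hk).le (pow_nonneg (inv_nonneg.mpr (Nat.cast_nonneg L)) _)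
  have h := hV p
  calc GaugeGroup.dist1 (GaugeField.plaqHol (ukAll X.Uk k V) p) < c * eps1Of S 𝔎.carrier k * ((L : ℝ)⁻¹) ^ (2 * k) := h
    _ = c * (eps1Of S 𝔎.carrier k * ((L : ℝ)⁻¹) ^ (2 * k)) := by ring
    _ ≤ c' * (eps1Of S 𝔎.carrier k * ((L : ℝ)⁻¹) ^ (2 * k)) := mul_le_mul_of_nonneg_right hcc' hε
    _ = c' * eps1Of S 𝔎.carrier k * ((L : ℝ)⁻¹) ^ (2 * k) := by ring

/-- The (4)-window of level `0` lies in print's window of level `0` as soon as `c ≥ 1`. [cite: Balaban1985UV3, (4) p.256] -/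
theorem plaqSmall_subset_chiMinAC_zero {c : ℝ} (hc : 1 ≤ c) :
    {V : GaugeField S.P 0 G | PlaqSmall (eps1Of S 𝔎.carrier 0) V} ⊆ chiMinAC 𝔎 X c 0 := by
  intro V hV
  rw [mem_chiMinAC_zero_iff]
  intro p
  have hε : 0 ≤ eps1Of S 𝔎.carrier 0 := (eps1Of_carrier_pos 𝔎 0 (Nat.zero_le _)).le
  calc GaugeGroup.dist1 (GaugeField.plaqHol V p) < eps1Of S 𝔎.carrier 0 := hV p
    _ = 1 * eps1Of S 𝔎.carrier 0 := (one_mul _).symm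
    _ ≤ c * eps1Of S 𝔎.carrier 0 := mul_le_mul_of_nonneg_right hc hε

/-- **PRINT'S WINDOW IS MEASURABLE** whenever the composite minimiser at the trivial history `U_k(·, triv)` is ([Balaban1985Variational] Thm 1: the row `hU` of the
(α) record; `ukAll X.Uk k = X.UkH k triv` by (42) at the trivial history). [cite: Balaban1985UV3, (42) p.266] -/
theorem measurableSet_chiMinAC [RegularGaugeGroup G] (c : ℝ) (k : ℕ) (hU : Measurable (X.UkH k (Hist.triv S.P k))) :
    MeasurableSet (chiMinAC 𝔎 X c k) := by
  have hset : chiMinAC 𝔎 X c k =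
      (X.UkH k (Hist.triv S.P k)) ⁻¹' {U : GaugeField S.P 0 G | PlaqSmall (c * eps1Of S 𝔎.carrier k * ((L : ℝ)⁻¹) ^ (2 * k)) U} := by
    ext V
    rw [mem_chiMinAC_iff, Set.mem_preimage, Set.mem_setOf_eq, X.UkH_triv]
  rw [hset]
  exact hU (T3UnitScaleTilt.measurableSet_plaqSmall _)

/-! ## §2 The lower step row on a validity family -/

/-- **THE LOWER STEP ROW ON THE VALIDITY FAMILY `lo` AT STEP `k`** (hypothesis schema, never asserted): for `dV`-a.e. `V`,
`𝟙[lo (k+1)](V)·exp[−mainT_{k+1}(triv,V) − E_k + (log σ₀ + d log g_k)·⋆B(triv) + logZU(triv,V) + Pold(triv,V) − Rm_k + logFl(triv,V)]`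
`≤ T_k[ 𝟙[lo k]·exp(−mainT_k(triv,·) + Pint_k(triv,·) − E_k − Rm_k) ](V)` — the lane's R3D-02 display `Bound55AC.Fibre57LowAC` with the tower's (4)-window
`T.χ` replaced on BOTH sides by the indicator of the validity family (exponents unchanged).  With `lo := chiMinAC 𝔎 X c` this is print's lower step: (37)
p.265 («They give the inequality (37) ρ₁(V) ≥ χ₁ exp[…]», χ₁ on the minimiser) and p.272 L32–33 «The lower bound is proved in the same way, with all
simplifications coming from the fact that Ω_{k+1} = T_η» — print's `χ_{k+1}` on the LEFT, print's `χ_k` INSIDE the fibre integral, no field window of (7)/(40)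
inside.  A (β) ρ-display ASSUMED (status: RESIDUAL of the v3 package, replacing `fibre57Low : Fibre57LowAC …`).
[cite: Balaban1985UV3, p.265 L21–28 + (47) p.267 + p.272 L32–33] -/
def Fibre57LowOnAC (lo : (k : ℕ) → Set (GaugeField S.P k G)) (k : ℕ) : Prop :=
  (fun V => (lo (k + 1)).indicator (fun _ => (1 : ℝ)) V *
      Real.exp (-((towerOfAC 𝔎 X 𝔖).mainT (k + 1) (Hist.triv S.P (k + 1)) V) - (towerOfAC 𝔎 X 𝔖).Ecst k
        + ((piecesAC 𝔎 X 𝔖 k).logσ₀ + (piecesAC 𝔎 X 𝔖 k).dg * Real.log ((towerOfAC 𝔎 X 𝔖).g k)) *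
            (piecesAC 𝔎 X 𝔖 k).starB (Hist.triv S.P (k + 1))
        + (piecesAC 𝔎 X 𝔖 k).logZU (Hist.triv S.P (k + 1)) V + (piecesAC 𝔎 X 𝔖 k).Pold (Hist.triv S.P (k + 1)) V
        - (towerOfAC 𝔎 X 𝔖).Rm k + (piecesAC 𝔎 X 𝔖 k).logFl (Hist.triv S.P (k + 1)) V))
    ≤ᵐ[fieldMeasure S.P (k + 1) G]
  rnTransport (X.av k).avg (fun U => (lo k).indicator (fun _ => (1 : ℝ)) U *
      Real.exp (-((towerOfAC 𝔎 X 𝔖).mainT k (Hist.triv S.P k) U) + (towerOfAC 𝔎 X 𝔖).Pint k (Hist.triv S.P k) U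
        - (towerOfAC 𝔎 X 𝔖).Ecst k - (towerOfAC 𝔎 X 𝔖).Rm k))

/-- The row is ANTITONE in the left set and MONOTONE in the inside set: shrinking `lo (k+1)` or enlarging `lo k` weakens it (used to compare the
`c = 1` and `c = max B₃ 1` readings). [folklore] -/
theorem fibre57LowOnAC_mono {lo lo' : (k : ℕ) → Set (GaugeField S.P k G)} (k : ℕ)
    (hleft : lo' (k + 1) ⊆ lo (k + 1)) (hin : lo k ⊆ lo' k) (hlo : MeasurableSet (lo k)) (hlo' : MeasurableSet (lo' k))
    (hint : Integrable (fun U => Real.exp (-((towerOfAC 𝔎 X 𝔖).mainT k (Hist.triv S.P k) U) + (towerOfAC 𝔎 X 𝔖).Pint k (Hist.triv S.P k) U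
        - (towerOfAC 𝔎 X 𝔖).Ecst k - (towerOfAC 𝔎 X 𝔖).Rm k)) (fieldMeasure S.P k G))
    (h : Fibre57LowOnAC 𝔎 X 𝔖 lo k) : Fibre57LowOnAC 𝔎 X 𝔖 lo' k := by
  have hi1 : ∀ (s : Set (GaugeField S.P k G)) (U : GaugeField S.P k G), s.indicator (fun _ => (1 : ℝ)) U ≤ 1 :=
    fun s U => Set.indicator_le_self' (fun _ _ => zero_le_one) U
  have hi0 : ∀ (s : Set (GaugeField S.P k G)) (U : GaugeField S.P k G), 0 ≤ s.indicator (fun _ => (1 : ℝ)) U :=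
    fun s U => Set.indicator_nonneg (fun _ _ => zero_le_one) U
  have hintS : ∀ s : Set (GaugeField S.P k G), MeasurableSet s → Integrable (fun U => s.indicator (fun _ => (1 : ℝ)) U *
      Real.exp (-((towerOfAC 𝔎 X 𝔖).mainT k (Hist.triv S.P k) U) + (towerOfAC 𝔎 X 𝔖).Pint k (Hist.triv S.P k) U
        - (towerOfAC 𝔎 X 𝔖).Ecst k - (towerOfAC 𝔎 X 𝔖).Rm k)) (fieldMeasure S.P k G) := fun s hs =>
    hint.mono' (((measurable_const.indicator hs).aestronglyMeasurable).mul hint.aestronglyMeasurable) (ae_of_all _ fun U => by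
      rw [Real.norm_eq_abs, abs_of_nonneg (mul_nonneg (hi0 s U) (Real.exp_pos _).le)]
      calc s.indicator (fun _ => (1 : ℝ)) U * _ ≤ 1 * _ := mul_le_mul_of_nonneg_right (hi1 s U) (Real.exp_pos _).le
        _ = _ := one_mul _)
  have hmono := rnTransport_mono_ae (X.av_ac k)
    (ρ₁ := fun U => (lo k).indicator (fun _ => (1 : ℝ)) U *
      Real.exp (-((towerOfAC 𝔎 X 𝔖).mainT k (Hist.triv S.P k) U) + (towerOfAC 𝔎 X 𝔖).Pint k (Hist.triv S.P k) U
        - (towerOfAC 𝔎 X 𝔖).Ecst k - (towerOfAC 𝔎 X 𝔖).Rm k))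
    (ρ₂ := fun U => (lo' k).indicator (fun _ => (1 : ℝ)) U *
      Real.exp (-((towerOfAC 𝔎 X 𝔖).mainT k (Hist.triv S.P k) U) + (towerOfAC 𝔎 X 𝔖).Pint k (Hist.triv S.P k) U
        - (towerOfAC 𝔎 X 𝔖).Ecst k - (towerOfAC 𝔎 X 𝔖).Rm k))
    (fun U => mul_le_mul_of_nonneg_right (Set.indicator_le_indicator_of_subset hin (fun _ => zero_le_one) U) (Real.exp_pos _).le)
    (hintS _ hlo) (hintS _ hlo')
  filter_upwards [h, hmono] with V hV hM
  refine le_trans ?_ (hV.trans hM)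
  exact mul_le_mul_of_nonneg_right (Set.indicator_le_indicator_of_subset hleft (fun _ => zero_le_one) V) (Real.exp_pos _).le

/-! ## §3 The `dV`-a.e. (47)-chain on the validity family -/

variable [RegularGaugeGroup G]

/-- The (47)_k minorant on the validity family, `𝟙[lo k]·e^{(47)_k exponent at triv}`, is integrable, given the data rows of level `k`
(`U_k(·,triv)` measurable, `Pint_k(triv,·)` measurable and `≤ cP`; `mainT ≥ 0`). [folklore] -/
theorem integrable_lowOn (lo : (k : ℕ) → Set (GaugeField S.P k G)) (k : ℕ) (hlo : MeasurableSet (lo k))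
    (hU : Measurable (X.UkH k (Hist.triv S.P k))) (hPm : Measurable ((inputOfAC 𝔎 X 𝔖).Pint k (Hist.triv S.P k))) (cP : ℝ)
    (hPb : ∀ U : GaugeField S.P k G, (inputOfAC 𝔎 X 𝔖).Pint k (Hist.triv S.P k) U ≤ cP) :
    Integrable (fun U => (lo k).indicator (fun _ => (1 : ℝ)) U *
      Real.exp (-((towerOfAC 𝔎 X 𝔖).mainT k (Hist.triv S.P k) U) + (towerOfAC 𝔎 X 𝔖).Pint k (Hist.triv S.P k) U
        - (towerOfAC 𝔎 X 𝔖).Ecst k - (towerOfAC 𝔎 X 𝔖).Rm k)) (fieldMeasure S.P k G) := by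
  have hmain : ∀ U, (towerOfAC 𝔎 X 𝔖).mainT k (Hist.triv S.P k) U = (S.gk k)⁻¹ ^ 2 * S.actionEta k (X.UkH k (Hist.triv S.P k) U) :=
    fun _ => rfl
  refine integrable_weight_mul_exp (measurable_const.indicator hlo) (fun U => Set.indicator_nonneg (fun _ _ => zero_le_one) U)
    (fun U => Set.indicator_le_self' (fun _ _ => zero_le_one) U) ?_
    (c := cP - (towerOfAC 𝔎 X 𝔖).Ecst k - (towerOfAC 𝔎 X 𝔖).Rm k) ?_
  · simp_rw [hmain]
    exact (((measurable_const.mul ((Bound55Std.measurable_actionEta (S := S) k).comp hU)).neg.add hPm).sub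
      measurable_const).sub measurable_const
  · intro U
    have h0 : 0 ≤ (towerOfAC 𝔎 X 𝔖).mainT k (Hist.triv S.P k) U := by
      rw [hmain]; exact mul_nonneg (sq_nonneg _) (Bound55Std.actionEta_nonneg (S := S) k _)
    have h1 : (towerOfAC 𝔎 X 𝔖).Pint k (Hist.triv S.P k) U ≤ cP := hPb U
    linarith

omit [RegularGaugeGroup G] in
/-- **(1) p.256 WITH NO CHARACTERISTIC FUNCTION**: `ρ₀(V) = exp(−mainT₀(triv,V) + Pint₀(triv,V) − E₀ − Rm₀)` for the lane's AC tower (one history,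
`U₀ = id`, `Pint₀ ≡ 0`, `Rm₀ = 0`; `Step0Tower.step0Data_towerObjects`). [cite: Balaban1985UV3, (1) p.256] -/
theorem rho_zero_eq_exp (V : GaugeField S.P 0 G) :
    (towerOfAC 𝔎 X 𝔖).ρ 0 V = Real.exp (-((towerOfAC 𝔎 X 𝔖).mainT 0 (Hist.triv S.P 0) V) + (towerOfAC 𝔎 X 𝔖).Pint 0 (Hist.triv S.P 0) V
        - (towerOfAC 𝔎 X 𝔖).Ecst 0 - (towerOfAC 𝔎 X 𝔖).Rm 0) := by
  have D := Summit.QuantumFields.Balaban3D.Proofs.Step0Tower.step0Data_towerObjects (towerWAC 𝔎 X 𝔖).pin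
    (fun V F => lfAC_zero (inputOfAC 𝔎 X 𝔖).W V F)
    (fun V => by
      show (run3 ((inputOfAC 𝔎 X 𝔖).toRunInput fun _ => True)).Uk 0 V = V
      rw [TowerInputAC.ukAll_eq]; rfl)
    (fun _ _ => rfl)
  have hρ : (towerOfAC 𝔎 X 𝔖).ρ 0 V = Real.exp (-(((towerOfAC 𝔎 X 𝔖).g 0)⁻¹ ^ 2 * (towerOfAC 𝔎 X 𝔖).wilsonBG 0 V) - (towerOfAC 𝔎 X 𝔖).Ecst 0) :=
    D.rho_zero V
  have hP : (towerOfAC 𝔎 X 𝔖).Pint 0 (Hist.triv S.P 0) V = 0 := D.pint_zero (Hist.triv S.P 0) V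
  have hR : (towerOfAC 𝔎 X 𝔖).Rm 0 = 0 := D.rm_zero
  have hM : (towerOfAC 𝔎 X 𝔖).mainT 0 (Hist.triv S.P 0) V = ((towerOfAC 𝔎 X 𝔖).g 0)⁻¹ ^ 2 * (towerOfAC 𝔎 X 𝔖).wilsonBG 0 V :=
    (towerOfAC 𝔎 X 𝔖).mainT_triv 0 V
  rw [hρ, hP, hR, hM]
  congr 1
  ring

/-- **BAŁABAN CMP 102 (47) ON THE VALIDITY FAMILY, `dV`-A.E., EVERY LEVEL `j ≤ K`** — for the lane's AC tower over ANY scales and AC inputs: if the lower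
rows `Fibre57LowOnAC 𝔎 X 𝔖 lo k` hold for every `k < K`, the sets `lo k` are measurable, the data rows hold, and the χ-FREE exponent step of the leaves
holds (`hexp`: the (47)_{k+1} exponent at the trivial history is below the (37)/(57) exponent — LQB's lower gathering, in the tree
`LogComparisonRepAtHeights.ineq47_exponent_succ_le` fed by C4–C8, C10 and the run identities; supplied by the caller in the tower's letters), then
`𝟙[lo j](V)·exp(−mainT_j(triv,V) + Pint_j(triv,V) − E_j − Rm_j) ≤ ρ_j(V)` for `dV`-a.e. `V`, every `j ≤ K`.  Induction on `j`: (47)₀ is (1) with no χ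
(`rho_zero_eq_exp`); the step transports the a.e. inequality by the monotone RN transport (through `max(minorant, ρ_j) = ρ_j` a.e.,
`Carriers.rnTransport_congr_ae`), uses the honesty `ρ_{j+1} = T_jρ_j` a.e. (`run3_rho_succ_ae_eq_rn`), the row VERBATIM, and `hexp`.  Print's (47) is the
instance `lo := chiMinAC 𝔎 X 1`.  No characteristic function of the tower is read. [cite: Balaban1985UV3, (47) p.267 + p.272 L32–33 + Thm 2 p.272] -/
theorem ineq47On_ae (lo : (k : ℕ) → Set (GaugeField S.P k G)) (hlo : ∀ k, k ≤ S.K → MeasurableSet (lo k))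
    (hrow : ∀ k, k + 1 ≤ S.K → Fibre57LowOnAC 𝔎 X 𝔖 lo k)
    (hexp : ∀ k, k + 1 ≤ S.K → ∀ V : GaugeField S.P (k + 1) G,
      -((towerOfAC 𝔎 X 𝔖).mainT (k + 1) (Hist.triv S.P (k + 1)) V) + (towerOfAC 𝔎 X 𝔖).Pint (k + 1) (Hist.triv S.P (k + 1)) V
          - (towerOfAC 𝔎 X 𝔖).Ecst (k + 1) - (towerOfAC 𝔎 X 𝔖).Rm (k + 1) ≤
        -((towerOfAC 𝔎 X 𝔖).mainT (k + 1) (Hist.triv S.P (k + 1)) V) - (towerOfAC 𝔎 X 𝔖).Ecst k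
          + ((piecesAC 𝔎 X 𝔖 k).logσ₀ + (piecesAC 𝔎 X 𝔖 k).dg * Real.log ((towerOfAC 𝔎 X 𝔖).g k)) *
              (piecesAC 𝔎 X 𝔖 k).starB (Hist.triv S.P (k + 1))
          + (piecesAC 𝔎 X 𝔖 k).logZU (Hist.triv S.P (k + 1)) V + (piecesAC 𝔎 X 𝔖 k).Pold (Hist.triv S.P (k + 1)) V
          - (towerOfAC 𝔎 X 𝔖).Rm k + (piecesAC 𝔎 X 𝔖 k).logFl (Hist.triv S.P (k + 1)) V)
    (hU : ∀ k, k ≤ S.K → Measurable (X.UkH k (Hist.triv S.P k)))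
    (hPm : ∀ k, k ≤ S.K → Measurable ((inputOfAC 𝔎 X 𝔖).Pint k (Hist.triv S.P k)))
    (hPb : ∀ k, k ≤ S.K → ∃ cP : ℝ, ∀ U : GaugeField S.P k G, (inputOfAC 𝔎 X 𝔖).Pint k (Hist.triv S.P k) U ≤ cP) :
    ∀ j : ℕ, j ≤ S.K → ∀ᵐ V ∂(fieldMeasure S.P j G),
      (lo j).indicator (fun _ => (1 : ℝ)) V *
          Real.exp (-((towerOfAC 𝔎 X 𝔖).mainT j (Hist.triv S.P j) V) + (towerOfAC 𝔎 X 𝔖).Pint j (Hist.triv S.P j) V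
            - (towerOfAC 𝔎 X 𝔖).Ecst j - (towerOfAC 𝔎 X 𝔖).Rm j) ≤ (towerOfAC 𝔎 X 𝔖).ρ j V := by
  intro j
  induction j with
  | zero =>
    intro _
    refine ae_of_all _ fun V => ?_
    rw [rho_zero_eq_exp 𝔎 X 𝔖 V]
    calc (lo 0).indicator (fun _ => (1 : ℝ)) V * _ ≤ 1 * _ :=
          mul_le_mul_of_nonneg_right (Set.indicator_le_self' (fun _ _ => zero_le_one) V) (Real.exp_pos _).le
      _ = _ := one_mul _
  | succ j ih =>
    intro hj
    have hjK : j ≤ S.K := by omega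
    have ihj := ih hjK
    obtain ⟨cP, hcP⟩ := hPb j hjK
    -- the level-`j` minorant `f` and its integrability
    set f : GaugeField S.P j G → ℝ := fun U => (lo j).indicator (fun _ => (1 : ℝ)) U *
      Real.exp (-((towerOfAC 𝔎 X 𝔖).mainT j (Hist.triv S.P j) U) + (towerOfAC 𝔎 X 𝔖).Pint j (Hist.triv S.P j) U
        - (towerOfAC 𝔎 X 𝔖).Ecst j - (towerOfAC 𝔎 X 𝔖).Rm j) with hf
    have hf0 : ∀ U, 0 ≤ f U := fun U => mul_nonneg (Set.indicator_nonneg (fun _ _ => zero_le_one) U) (Real.exp_pos _).le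
    have hfi : Integrable f (fieldMeasure S.P j G) := integrable_lowOn 𝔎 X 𝔖 lo j (hlo j hjK) (hU j hjK) (hPm j hjK) cP hcP
    -- the density `ρ_j`, non-negative and integrable (honesty of the version selection is used below)
    have hpin : ∀ i, (towerOfAC 𝔎 X 𝔖).ρ i = (towerWAC 𝔎 X 𝔖).rho i := fun i => (towerWAC 𝔎 X 𝔖).pin_rho i
    have hρ0 : ∀ U, 0 ≤ (towerOfAC 𝔎 X 𝔖).ρ j U := fun U => by
      rw [hpin]; exact run3_rho_nonneg ((inputOfAC 𝔎 X 𝔖).toRunInput fun _ => True) j U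
    have hρi : Integrable ((towerOfAC 𝔎 X 𝔖).ρ j) (fieldMeasure S.P j G) := by
      rw [hpin]; exact run3_rho_integrable ((inputOfAC 𝔎 X 𝔖).toRunInput fun _ => True) j
    -- `g := max f ρ_j` dominates `f` pointwise and equals `ρ_j` a.e.
    set g : GaugeField S.P j G → ℝ := fun U => max (f U) ((towerOfAC 𝔎 X 𝔖).ρ j U) with hg
    have hfg : ∀ U, f U ≤ g U := fun U => le_max_left _ _
    have hg0 : ∀ U, 0 ≤ g U := fun U => (hρ0 U).trans (le_max_right _ _)
    have hgae : g =ᵐ[fieldMeasure S.P j G] (towerOfAC 𝔎 X 𝔖).ρ j := by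
      filter_upwards [ihj] with U hU
      exact max_eq_right hU
    have hgi : Integrable g (fieldMeasure S.P j G) := hρi.congr hgae.symm
    -- transport: `T f ≤ T g = T ρ_j` a.e.
    have h1 : rnTransport (X.av j).avg f ≤ᵐ[fieldMeasure S.P (j + 1) G] rnTransport (X.av j).avg g :=
      rnTransport_mono_ae (X.av_ac j) hfg hfi hgi
    have h2 : rnTransport (X.av j).avg g = rnTransport (X.av j).avg ((towerOfAC 𝔎 X 𝔖).ρ j) :=
      rnTransport_congr_ae hgae hg0 hρ0
    -- honesty: `ρ_{j+1} = T_j ρ_j` a.e.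
    have h3 : ∀ᵐ V ∂(fieldMeasure S.P (j + 1) G),
        (towerOfAC 𝔎 X 𝔖).ρ (j + 1) V = rnTransport (X.av j).avg ((towerOfAC 𝔎 X 𝔖).ρ j) V := by
      filter_upwards [run3_rho_succ_ae_eq_rn ((inputOfAC 𝔎 X 𝔖).toRunInput fun _ => True) j] with V hV
      rw [hpin (j + 1), hpin j]
      exact hV
    -- the row at step `j` and the exponent step
    filter_upwards [hrow j hj, h1, h3] with V hV hM hT
    rw [hT, ← h2]
    refine le_trans ?_ (hV.trans hM)
    exact mul_le_mul_of_nonneg_left (Real.exp_le_exp.mpr (hexp j hj V)) (Set.indicator_nonneg (fun _ _ => zero_le_one) V)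

/-! ## §4 The pointwise (47) for the tower's (4)-window as a corollary -/

omit [RegularGaugeGroup G] in
/-- The tower's characteristic function IS the indicator of the (4)-window at `ε₁(k) = g_kp(g_k)` (spine `RunObjects.chi`, by `rfl`); hence it is
dominated by the indicator of any set containing that window. [cite: Balaban1985UV3, (4) p.256] -/
theorem chi_le_indicator_of_subset (lo : (k : ℕ) → Set (GaugeField S.P k G)) (k : ℕ)
    (hsub : {V : GaugeField S.P k G | PlaqSmall (eps1Of S 𝔎.carrier k) V} ⊆ lo k) (V : GaugeField S.P k G) :
    (towerOfAC 𝔎 X 𝔖).χ k V ≤ (lo k).indicator (fun _ => (1 : ℝ)) V := by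
  have hchi : (towerOfAC 𝔎 X 𝔖).χ k V = chiSmall Set.univ (eps1Of S 𝔎.carrier k) V := rfl
  rw [hchi]
  unfold chiSmall
  split_ifs with hs
  · have hV : V ∈ lo k := hsub (show PlaqSmall (eps1Of S 𝔎.carrier k) V from fun p => hs p (Set.mem_univ p))
    rw [Set.indicator_of_mem hV]
  · exact Set.indicator_nonneg (fun _ _ => zero_le_one) V

/-- **BAŁABAN CMP 102 (47) FOR THE TOWER'S OWN (4)-WINDOW, POINTWISE, FROM THE ROWS ON A VALIDITY FAMILY CONTAINING THE WINDOWS** — LQB's `B10.Ineq47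
(towerOfAC 𝔎 X 𝔖) k` for every `k ≤ K`: under the hypotheses of `ineq47On_ae` and `hsub` (the (4)-window of every level `k ≤ K` lies inside `lo k`; at the
T³ socket with `lo := chiMinAC … (max B₃ 1)` this is [Balaban1985Variational] Thm 1 (8), the record's minimiser row r1), the lower barrier of the run's
version selection `T.χ_{k+1}·e^{(57) at triv}` (`SeriesAC.lowerOfAC`, pinned by `rfl`) is `dV`-a.e. below the RN transport of `ρ_k` (a.e. chain at level `k`
+ `hsub` + monotonicity), so the selection puts it below `ρ_{k+1}` EVERYWHERE (`Carriers.run3_lower_le_rho_succ`), and the exponent step `hexp` turns the barrier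
into (47)_{k+1}; (47)₀ is `Thm2AC.step0_towerOfAC`.  Every consumer of the field-window (47)′ keeps its statement. [cite: Balaban1985UV3, (47) p.267 + Thm 2 p.272] -/
theorem ineq47_of_onRows (lo : (k : ℕ) → Set (GaugeField S.P k G)) (hlo : ∀ k, k ≤ S.K → MeasurableSet (lo k))
    (hrow : ∀ k, k + 1 ≤ S.K → Fibre57LowOnAC 𝔎 X 𝔖 lo k)
    (hexp : ∀ k, k + 1 ≤ S.K → ∀ V : GaugeField S.P (k + 1) G,
      -((towerOfAC 𝔎 X 𝔖).mainT (k + 1) (Hist.triv S.P (k + 1)) V) + (towerOfAC 𝔎 X 𝔖).Pint (k + 1) (Hist.triv S.P (k + 1)) V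
          - (towerOfAC 𝔎 X 𝔖).Ecst (k + 1) - (towerOfAC 𝔎 X 𝔖).Rm (k + 1) ≤
        -((towerOfAC 𝔎 X 𝔖).mainT (k + 1) (Hist.triv S.P (k + 1)) V) - (towerOfAC 𝔎 X 𝔖).Ecst k
          + ((piecesAC 𝔎 X 𝔖 k).logσ₀ + (piecesAC 𝔎 X 𝔖 k).dg * Real.log ((towerOfAC 𝔎 X 𝔖).g k)) *
              (piecesAC 𝔎 X 𝔖 k).starB (Hist.triv S.P (k + 1))
          + (piecesAC 𝔎 X 𝔖 k).logZU (Hist.triv S.P (k + 1)) V + (piecesAC 𝔎 X 𝔖 k).Pold (Hist.triv S.P (k + 1)) V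
          - (towerOfAC 𝔎 X 𝔖).Rm k + (piecesAC 𝔎 X 𝔖 k).logFl (Hist.triv S.P (k + 1)) V)
    (hU : ∀ k, k ≤ S.K → Measurable (X.UkH k (Hist.triv S.P k)))
    (hPm : ∀ k, k ≤ S.K → Measurable ((inputOfAC 𝔎 X 𝔖).Pint k (Hist.triv S.P k)))
    (hPb : ∀ k, k ≤ S.K → ∃ cP : ℝ, ∀ U : GaugeField S.P k G, (inputOfAC 𝔎 X 𝔖).Pint k (Hist.triv S.P k) U ≤ cP)
    (hsub : ∀ k, k ≤ S.K → {V : GaugeField S.P k G | PlaqSmall (eps1Of S 𝔎.carrier k) V} ⊆ lo k) :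
    ∀ k, k ≤ S.K → Ineq47 (towerOfAC 𝔎 X 𝔖) k := by
  intro k
  cases k with
  | zero => exact fun _ => (Summit.QuantumFields.Balaban3D.Proofs.Thm2AC.step0_towerOfAC 𝔎 X 𝔖).2
  | succ k =>
    intro hk
    have hkK : k ≤ S.K := by omega
    have hchain := ineq47On_ae 𝔎 X 𝔖 lo hlo hrow hexp hU hPm hPb k hkK
    obtain ⟨cP, hcP⟩ := hPb k hkK
    -- the level-`k` minorant, `ρ_k`, and `T f ≤ T ρ_k` a.e. (as in the chain)
    set f : GaugeField S.P k G → ℝ := fun U => (lo k).indicator (fun _ => (1 : ℝ)) U *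
      Real.exp (-((towerOfAC 𝔎 X 𝔖).mainT k (Hist.triv S.P k) U) + (towerOfAC 𝔎 X 𝔖).Pint k (Hist.triv S.P k) U
        - (towerOfAC 𝔎 X 𝔖).Ecst k - (towerOfAC 𝔎 X 𝔖).Rm k) with hf
    have hfi : Integrable f (fieldMeasure S.P k G) := integrable_lowOn 𝔎 X 𝔖 lo k (hlo k hkK) (hU k hkK) (hPm k hkK) cP hcP
    have hpin : ∀ i, (towerOfAC 𝔎 X 𝔖).ρ i = (towerWAC 𝔎 X 𝔖).rho i := fun i => (towerWAC 𝔎 X 𝔖).pin_rho i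
    have hρ0 : ∀ U, 0 ≤ (towerOfAC 𝔎 X 𝔖).ρ k U := fun U => by
      rw [hpin]; exact run3_rho_nonneg ((inputOfAC 𝔎 X 𝔖).toRunInput fun _ => True) k U
    have hρi : Integrable ((towerOfAC 𝔎 X 𝔖).ρ k) (fieldMeasure S.P k G) := by
      rw [hpin]; exact run3_rho_integrable ((inputOfAC 𝔎 X 𝔖).toRunInput fun _ => True) k
    set g : GaugeField S.P k G → ℝ := fun U => max (f U) ((towerOfAC 𝔎 X 𝔖).ρ k U) with hg
    have hfg : ∀ U, f U ≤ g U := fun U => le_max_left _ _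
    have hg0 : ∀ U, 0 ≤ g U := fun U => (hρ0 U).trans (le_max_right _ _)
    have hgae : g =ᵐ[fieldMeasure S.P k G] (towerOfAC 𝔎 X 𝔖).ρ k := by
      filter_upwards [hchain] with U hU
      exact max_eq_right hU
    have hgi : Integrable g (fieldMeasure S.P k G) := hρi.congr hgae.symm
    have h1 : rnTransport (X.av k).avg f ≤ᵐ[fieldMeasure S.P (k + 1) G] rnTransport (X.av k).avg g :=
      rnTransport_mono_ae (X.av_ac k) hfg hfi hgi
    have h2 : rnTransport (X.av k).avg g = rnTransport (X.av k).avg ((towerOfAC 𝔎 X 𝔖).ρ k) :=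
      rnTransport_congr_ae hgae hg0 hρ0
    -- the run's LOWER barrier of step `k` is `T.χ_{k+1}·e^{(57) at triv}` (pinned by `rfl`), below `T_k ρ_k` a.e.
    have hlo_ae : ∀ᵐ V ∂(fieldMeasure S.P (k + 1) G),
        ((inputOfAC 𝔎 X 𝔖).toRunInput fun _ => True).lower k V ≤
          rnTransport (((inputOfAC 𝔎 X 𝔖).toRunInput fun _ => True).av k).avg
            ((run3 ((inputOfAC 𝔎 X 𝔖).toRunInput fun _ => True)).rho k) V := by
      filter_upwards [hrow k hk, h1] with V hV hM
      have hlower : ((inputOfAC 𝔎 X 𝔖).toRunInput fun _ => True).lower k V =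
          (towerOfAC 𝔎 X 𝔖).χ (k + 1) V *
            Real.exp (-((towerOfAC 𝔎 X 𝔖).mainT (k + 1) (Hist.triv S.P (k + 1)) V) - (towerOfAC 𝔎 X 𝔖).Ecst k
              + ((piecesAC 𝔎 X 𝔖 k).logσ₀ + (piecesAC 𝔎 X 𝔖 k).dg * Real.log ((towerOfAC 𝔎 X 𝔖).g k)) *
                  (piecesAC 𝔎 X 𝔖 k).starB (Hist.triv S.P (k + 1))
              + (piecesAC 𝔎 X 𝔖 k).logZU (Hist.triv S.P (k + 1)) V + (piecesAC 𝔎 X 𝔖 k).Pold (Hist.triv S.P (k + 1)) V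
              - (towerOfAC 𝔎 X 𝔖).Rm k + (piecesAC 𝔎 X 𝔖 k).logFl (Hist.triv S.P (k + 1)) V) := rfl
      have hρk : (run3 ((inputOfAC 𝔎 X 𝔖).toRunInput fun _ => True)).rho k = (towerOfAC 𝔎 X 𝔖).ρ k := (hpin k).symm
      rw [hlower, hρk]
      change _ ≤ rnTransport (X.av k).avg ((towerOfAC 𝔎 X 𝔖).ρ k) V
      rw [← h2]
      refine le_trans ?_ (hV.trans hM)
      exact mul_le_mul_of_nonneg_right (chi_le_indicator_of_subset 𝔎 X 𝔖 lo (k + 1) (hsub (k + 1) hk) V) (Real.exp_pos _).le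
    -- the version selection puts the barrier below `ρ_{k+1}` EVERYWHERE
    intro U
    have hsel := run3_lower_le_rho_succ ((inputOfAC 𝔎 X 𝔖).toRunInput fun _ => True) k hlo_ae U
    have hρU : (run3 ((inputOfAC 𝔎 X 𝔖).toRunInput fun _ => True)).rho (k + 1) U = (towerOfAC 𝔎 X 𝔖).ρ (k + 1) U :=
      congrFun (hpin (k + 1)).symm U
    rw [hρU] at hsel
    refine le_trans ?_ hsel
    show (towerOfAC 𝔎 X 𝔖).χ (k + 1) U * _ ≤ (towerOfAC 𝔎 X 𝔖).χ (k + 1) U * _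
    exact mul_le_mul_of_nonneg_left (Real.exp_le_exp.mpr (hexp k hk U)) ((towerOfAC 𝔎 X 𝔖).χ_nonneg (k + 1) U)

end Summit.QuantumFields.YangMills.Theorems.PinnedStep

end
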